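import Literature.NumberTheory.EllipticCurves.CanonicalPAdicHeightLeavesProofs
import Literature.NumberTheory.EllipticCurves.FormalGroupLaw
import HarnessLib

/-!
# The canonical `p`-adic height: `padicSigma_theta` from the formal theta identity and the formal group law

Trunk T-NT-EC (Literature/NumberTheory/EllipticCurves); fourth proof file behind the named fact
`WeierstrassCurve.exists_isCanonical` (`CanonicalPAdicHeight.lean`). After
`CanonicalPAdicHeightLeavesProofs.lean` the existence of the canonical `p`-adic height datum
rested on ONE named fact, `WeierstrassCurve.padicSigma_theta`: the Mazur–Tate theta relation
`σ(P+Q)σ(P-Q) = (x(Q) - x(P)) σ(P)² σ(Q)²` for rational points of the kernel of reduction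
(Mazur–Tate 1991, Thm. 3.1, at points; Blakestad–Grant 2023, Prop. 14, formally). This file
splits it into its two mathematically distinct halves and PROVES the passage from them to
`padicSigma_theta`:

* `padicSigma_theta_formal` (named fact, θ₂) — the theta relation as an IDENTITY OF FORMAL POWER
  SERIES in `ℚ_p⟦u, v⟧` for a Mazur–Tate pair `(σ, c)` of `W ⊗ ℚ_p`:
  `σ(F(u,v)) σ(F(u,i(v))) u²v² = (u²·X(v) - v²·X(u)) σ(u)² σ(v)²`, where
  `F = formalGroupLaw` is the chord–tangent formal group law of AEC IV.1 (`FormalGroupLaw.lean`),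
  `i = formalNeg` the formal inverse and `X = formalXMulSq = z²x(z)` (Blakestad–Grant 2023,
  Prop. 14: "as elements in the fraction field of `R̂⟦t₁, t₂⟧`,
  `σ(t₁ +_𝓕 t₂)σ(t₁ -_𝓕 t₂)/(σ²(t₁)σ²(t₂)) = x(t₂) - x(t₁)`", `𝓕` "the formal group law in
  `R⟦t₁,t₂⟧` as in [Si, IV.1]", proved from the differential equation and oddness; Mazur–Tate
  1991, Thm. 3.1);
* `formalGroupLaw_padicEval` (named fact, θ₃) — the formal group law CONVERGES on `E₁(ℚ_p)` and
  COMPUTES THE CHORD-TANGENT SUM: `F(z(P), z(Q)) = z(P + Q)` for `P, Q ∈ E₁(ℚ_p)` (Silverman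
  AEC IV.1–IV.2 — "the power series formally giving the addition law",
  `F ∈ ℤ[a₁,…,a₆]⟦z₁,z₂⟧`, so it converges on `𝓜 × 𝓜` — and VII.2.2 — `E₁(K) ≅ Ê(𝓜)` via
  `z = -x/y`); the `p`-integrality of `F` is a THEOREM here (`isPadicInt_formalGroupLaw`);

and proves

* `padicSigma_theta_of_formal : mazur_tate_sigma_existsUnique → padicSigma_theta_formal →
  formalGroupLaw_padicEval → padicSigma_theta` — evaluate θ₂ at `(z(P), z(Q))` with the
  evaluation homomorphism of `PadicSeriesEvaluation.lean` (`padicEval₂_mul`, `padicEval₂_subst`,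
  `padicEval₂_substPair`), read `F̂(z P, z Q) = z(P+Q)`, `F̂(z P, î(z Q)) = z(P-Q)` from θ₃ and
  `î(z Q) = z(-Q)`, `X̂(z P) = x(P) z(P)²` from the PROVED dictionary
  (`FormalGroupDictionaryProofs.lean`), and cancel `z(P)² z(Q)² ≠ 0`;
* `exists_isCanonical_of_formal` — hence `exists_isCanonical` from the three named facts
  `mazur_tate_sigma_existsUnique` (MST 2006 Thm. 1.3, `PadicSigma.lean`),
  `padicSigma_theta_formal`, `formalGroupLaw_padicEval`.

Nothing is asserted: the two new named facts are `def … : Prop`.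

## Sources

* C. Blakestad, D. Grant, *On the universal `p`-adic sigma and Weierstrass zeta functions*,
  J. Number Theory 249 (2023) (arXiv:1903.02480): §3 p. 10 (Mazur–Tate's characterisation of
  `σ_{E/A}` by the theta property on the kernel of reduction; the formal group law
  `𝓕 = t₁ +_𝓕 t₂ ∈ R⟦t₁,t₂⟧` "as in [Si, IV.1]", `t₁ -_𝓕 t₂`), Prop. 14 and its proof
  (`D₁(D₁σ(t₁ +_𝓕 t₂)/σ(t₁ +_𝓕 t₂)) = -x(t₁ +_𝓕 t₂) + β`, oddness, leading terms), Thm. 15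
  (specialisation to the points `t₁ ↦ t(u)`, `t₂ ↦ t(v)`).
* B. Mazur, J. Tate, *The `p`-adic sigma function*, Duke Math. J. 62 (1991), Thm. 3.1 (as cited
  in Blakestad–Grant §3, in Silverman, *`p`-adic properties of division polynomials* (2004),
  Thm. 11, and in Mazur–Stein–Tate 2006, §2.7).
* B. Mazur, W. Stein, J. Tate, Doc. Math. Extra Vol. Coates (2006), Thm. 1.3 (`σ` the unique
  odd normalised integral solution of the sigma ODE), §2.7.
* J. H. Silverman, *AEC* 2nd ed. (2009): IV.1 (pp. 115–118: `w(z)`, `x(z)`, `y(z)`, `ω(z)`,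
  `i(z)`, `F(z₁,z₂) = i(z₃(z₁,z₂)) ∈ ℤ[a₁,…,a₆]⟦z₁,z₂⟧`, "the map `𝓜 → E(K)`"), IV.2,
  IV.4.2, IV.5.2–5.3 (`F(X,Y) = exp(log X + log Y)`), VII.2.2.

## Design notes

* θ₂ is stated for Mazur–Tate PAIRS of `W ⊗ ℚ_p` under the hypotheses of `padicSigma_theta`
  (`W/ℚ` globally minimal, `p ≥ 5` good ordinary), exactly where the sources print it
  (Blakestad–Grant prove it for the universal ordinary curve in short Weierstrass form; for a
  general model it follows from Mazur–Tate 1991 Thm. 3.1 at points and Mazur–Stein–Tate 2006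
  Thm. 1.3 by the identity theorem). Blakestad–Grant's argument gives it for ANY normalised odd
  solution of the sigma ODE over any `ℚ`-algebra; that generalisation is not asserted.
  θ₂ inherits from `padicSigma_theta` its dependence on the tree's encodings
  `SatisfiesSigmaODE`, `IsFormallyOdd` (`PadicSigma.lean`); the group law is the explicit
  chord–tangent series `formalGroupLaw` (`FormalGroupLaw.lean`, AEC IV.1), not the logarithmic
  `formalGroupLawQ` (their identification, AEC IV.5.3, is not needed on this path).
* θ₃ is stated for `formalGroupLaw` over `ℚ_p`, for `W/ℚ_p` elliptic with `p`-integral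
  coefficients (AEC VII.2.2 assumes a minimal equation but uses only integrality). Closure of
  `E₁(ℚ_p)` under `+` is not asserted (for the rational points used here it is the proved
  `kernelOfReductionAt`). θ₃ is provable in the tree's language: the chord construction
  evaluated at points (evaluation homomorphism + `FormalGroupDictionaryProofs`) against
  Mathlib's addition formulas; left to a later file.
* The two-variable encoding: `u = X 0`, `v = X 1` in `MvPowerSeries (Fin 2) ℚ_[p]`,
  `F(u, i(v)) = MvPowerSeries.subst ![X 0, i.subst (X 1)] F`, one-variable series read in a
  variable via `PowerSeries.subst (X i)`; poles of `x(z) = X(z)/z²` cleared by `u²v²`.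
-/

noncomputable section

open scoped Classical
open PowerSeries Literature.NumberTheory.EllipticCurves

namespace WeierstrassCurve

/-! ### The two sides of the theta identity, as formal power series in `u, v` -/

section ThetaSides

variable {A : Type*} [CommRing A] (V : WeierstrassCurve A) (σ : A⟦X⟧)

/-- `F(u, i(v)) = u -_F v ∈ A⟦u, v⟧`: the formal group law with the formal inverse substituted in
the second variable ("subtraction in the formal group", Blakestad–Grant 2023 §3).
[Blakestad–Grant 2023, §3 (`t₁ -_𝓕 t₂`); Silverman AEC IV.1 (`i`, `F`), IV.2] [cite: BlakestadGrant2023, §3] -/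
def formalGroupLawSub : MvPowerSeries (Fin 2) A :=
  MvPowerSeries.subst ![MvPowerSeries.X 0, V.formalNeg.subst (MvPowerSeries.X 1 : MvPowerSeries (Fin 2) A)]
    V.formalGroupLaw

/-- **Left side of the theta identity**, poles cleared:
`σ(F(u,v)) · σ(F(u,i(v))) · u² · v² ∈ A⟦u, v⟧`. [Blakestad–Grant 2023, Prop. 14 (numerator
`σ(t₁ +_𝓕 t₂)σ(t₁ -_𝓕 t₂)`)] [cite: BlakestadGrant2023, Prop. 14] -/
def thetaLHS : MvPowerSeries (Fin 2) A :=
  σ.subst V.formalGroupLaw * σ.subst V.formalGroupLawSub *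
    (MvPowerSeries.X 0) ^ 2 * (MvPowerSeries.X 1) ^ 2

/-- **Right side of the theta identity**, poles cleared:
`(u²·X(v) - v²·X(u)) · σ(u)² · σ(v)² ∈ A⟦u, v⟧` with `X = z²x(z) = formalXMulSq`, so that
`u²X(v) - v²X(u) = u²v²(x(v) - x(u))`. [Blakestad–Grant 2023, Prop. 14 (`x(t₂) - x(t₁)` times
`σ²(t₁)σ²(t₂)`)] [cite: BlakestadGrant2023, Prop. 14] -/
def thetaRHS : MvPowerSeries (Fin 2) A :=
  ((MvPowerSeries.X 0) ^ 2 * V.formalXMulSq.subst (MvPowerSeries.X 1 : MvPowerSeries (Fin 2) A) -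
      (MvPowerSeries.X 1) ^ 2 * V.formalXMulSq.subst (MvPowerSeries.X 0 : MvPowerSeries (Fin 2) A)) *
    σ.subst (MvPowerSeries.X 0 : MvPowerSeries (Fin 2) A) ^ 2 *
    σ.subst (MvPowerSeries.X 1 : MvPowerSeries (Fin 2) A) ^ 2

end ThetaSides

/-! ### Named facts: the next layer behind `padicSigma_theta` (nothing asserted) -/

/-- **θ₂ — the Mazur–Tate theta relation as a formal identity.** For `W/ℚ` globally minimal,
`p ≥ 5` of good ordinary reduction, and ANY Mazur–Tate pair `(σ, c)` of `W ⊗ ℚ_p`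
(`σ = t + ⋯ ∈ tℤ_p⟦t⟧` odd, satisfying the sigma differential equation
`x(t) + c = -(d/ω)((1/σ)(dσ/ω))`), in `ℚ_p⟦u, v⟧`:
`σ(F(u,v)) · σ(F(u,i(v))) · u²v² = (u²X(v) - v²X(u)) · σ(u)² · σ(v)²`,
i.e. `σ(u +_F v) σ(u -_F v)/(σ(u)² σ(v)²) = x(v) - x(u)` with the poles of `x = X/z²` cleared;
`F = formalGroupLaw` the chord–tangent formal group law (AEC IV.1), `i` the formal inverse.
Blakestad–Grant prove this for the universal ordinary curve (short Weierstrass form, `p > 3`)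
from the differential equation, oddness and the leading terms; for a general minimal model it
is Mazur–Tate's characterising property of `σ` (MT 1991 Thm. 3.1, at all points of the kernel
of reduction) combined with MST 2006 Thm. 1.3 (the pair is unique, so `σ` IS Mazur–Tate's
sigma function) and the identity theorem for `p`-adic power series.
[Blakestad–Grant 2023, Prop. 14; Mazur–Tate 1991, Thm. 3.1; Mazur–Stein–Tate 2006, Thm. 1.3,
§2.7] [cite: MazurTate1991, Thm. 3.1] [cite: BlakestadGrant2023, Prop. 14]
[cite: MazurSteinTate2006, Thm. 1.3] -/
def padicSigma_theta_formal : Prop :=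
  ∀ (W : WeierstrassCurve ℚ) [W.IsElliptic] [W.IsGloballyMinimal] (p : ℕ) [Fact p.Prime],
    5 ≤ p → W.HasGoodReductionAtPrime p → ¬ (p : ℤ) ∣ W.frobeniusTrace p →
      ∀ (σ : ℚ_[p]⟦X⟧) (c : ℚ_[p]), (W.baseChange ℚ_[p]).IsMazurTateSigmaPair σ c →
        (W.baseChange ℚ_[p]).thetaLHS σ = (W.baseChange ℚ_[p]).thetaRHS σ

/-- **θ₃ — the formal group law converges on `E₁(ℚ_p)` and computes the group law.** For an
elliptic curve over `ℚ_p` given by a Weierstrass equation `W` with `p`-integral coefficients and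
`P, Q ∈ E₁(ℚ_p)` (i.e. `P = O` or `‖x(P)‖ > 1`), the chord–tangent formal group law
`F(z₁, z₂) = i(z₃(z₁, z₂)) ∈ ℤ_p⟦z₁, z₂⟧` (AEC IV.1, `FormalGroupLaw.lean`; integral by
`isPadicInt_formalGroupLaw`) evaluated at the parameters `z(P) = -x(P)/y(P)`, `z(Q)` is the
parameter of the chord-tangent sum: `F(z(P), z(Q)) = z(P + Q)` — AEC IV.1: "the power series
formally giving the addition law on `E`"; AEC VII.2.2: `E₁(K) → Ê(𝓜)`, `P ↦ z(P)` is an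
isomorphism of groups (stated for a minimal equation; the proof uses only integrality).
[Silverman AEC IV.1 (pp. 116–118), IV.2, VII.2.2] [cite: SilvermanAEC2009, VII.2.2] -/
def formalGroupLaw_padicEval : Prop :=
  ∀ (p : ℕ) [Fact p.Prime] (W : WeierstrassCurve ℚ_[p]) [W.IsElliptic] [W.IsIntegral ℤ_[p]]
    (P Q : W.toAffine.Point), W.IsInReductionKernel P → W.IsInReductionKernel Q →
      padicEval₂ W.formalGroupLaw (W.formalParameter P) (W.formalParameter Q) =
        W.formalParameter (P + Q)

/-! ### Generic lemmas: constant terms, substitutability, integrality of the theta sides -/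

section Generic

variable {A : Type*} [CommRing A] (V : WeierstrassCurve A)

/-- `i(v)` read in the variable `v` has no constant term. [folklore] -/
theorem constantCoeff_formalNeg_subst_X (i : Fin 2) :
    MvPowerSeries.constantCoeff (V.formalNeg.subst (MvPowerSeries.X i : MvPowerSeries (Fin 2) A)) = 0 :=
  constantCoeff_powerSeries_subst_eq_zero (MvPowerSeries.constantCoeff_X i) V.constantCoeff_formalNeg

/-- The pair `(u, i(v))` is substitutable. [folklore] -/
theorem hasSubst_pair_formalNeg :
    MvPowerSeries.HasSubst ![MvPowerSeries.X 0,
      V.formalNeg.subst (MvPowerSeries.X 1 : MvPowerSeries (Fin 2) A)] :=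
  MvPowerSeries.hasSubst_of_constantCoeff_zero fun i => by
    fin_cases i
    · exact MvPowerSeries.constantCoeff_X 0
    · exact V.constantCoeff_formalNeg_subst_X 1

/-- `(u -_F v)(0, 0) = 0`. [folklore] -/
theorem constantCoeff_formalGroupLawSub : MvPowerSeries.constantCoeff V.formalGroupLawSub = 0 := by
  unfold formalGroupLawSub
  refine MvPowerSeries.constantCoeff_subst_eq_zero V.hasSubst_pair_formalNeg (fun i => ?_)
    V.constantCoeff_formalGroupLaw
  fin_cases i
  · exact MvPowerSeries.constantCoeff_X 0
  · exact V.constantCoeff_formalNeg_subst_X 1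

end Generic

section PadicIntegrality

variable {p : ℕ} [Fact p.Prime] (V : WeierstrassCurve ℚ_[p]) [V.IsIntegral ℤ_[p]]

/-- `u -_F v` is integral. [folklore] -/
theorem isPadicInt_formalGroupLawSub : IsPadicInt V.formalGroupLawSub :=
  V.isPadicInt_formalGroupLaw.subst (fun i => by
    fin_cases i
    · exact IsPadicInt.X 0
    · exact V.isPadicInt_formalNeg.powerSeries_subst (IsPadicInt.X 1) (PowerSeries.HasSubst.X 1))
    V.hasSubst_pair_formalNeg

variable {V} in
/-- The left side is integral for `σ` integral. [folklore] -/
theorem isPadicInt_thetaLHS {σ : ℚ_[p]⟦X⟧} (hσ : IsPadicInt σ) : IsPadicInt (V.thetaLHS σ) :=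
  (((hσ.powerSeries_subst V.isPadicInt_formalGroupLaw V.hasSubst_formalGroupLaw).mul
    (hσ.powerSeries_subst V.isPadicInt_formalGroupLawSub
    (PowerSeries.HasSubst.of_constantCoeff_zero V.constantCoeff_formalGroupLawSub))).mul
    ((IsPadicInt.X 0).pow 2)).mul ((IsPadicInt.X 1).pow 2)

variable {V} in
/-- The right side is integral for `σ` integral. [folklore] -/
theorem isPadicInt_thetaRHS {σ : ℚ_[p]⟦X⟧} (hσ : IsPadicInt σ) : IsPadicInt (V.thetaRHS σ) :=
  (((((IsPadicInt.X (0 : Fin 2)).pow 2).mul (V.isPadicInt_formalXMulSq.powerSeries_subst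
    (IsPadicInt.X (1 : Fin 2)) (PowerSeries.HasSubst.X 1))).sub
    (((IsPadicInt.X (1 : Fin 2)).pow 2).mul (V.isPadicInt_formalXMulSq.powerSeries_subst
    (IsPadicInt.X (0 : Fin 2)) (PowerSeries.HasSubst.X 0)))).mul
    ((hσ.powerSeries_subst (IsPadicInt.X (0 : Fin 2)) (PowerSeries.HasSubst.X 0)).pow 2)).mul
    ((hσ.powerSeries_subst (IsPadicInt.X (1 : Fin 2)) (PowerSeries.HasSubst.X 1)).pow 2)

/-! ### Evaluating the two sides at a pair of points of the open unit disc -/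

variable {V} in
/-- **Value of the left side**: `thetaLHS(u, v) = σ(F(u,v)) · σ(F(u, i(v))) · u² · v²`.
[folklore] -/
theorem padicEval₂_thetaLHS {σ : ℚ_[p]⟦X⟧} (hσ : IsPadicInt σ) {u v : ℚ_[p]} (hu : ‖u‖ < 1)
    (hv : ‖v‖ < 1) :
    padicEval₂ (V.thetaLHS σ) u v =
      padicEval σ (padicEval₂ V.formalGroupLaw u v) *
        padicEval σ (padicEval₂ V.formalGroupLaw u (padicEval V.formalNeg v)) * u ^ 2 * v ^ 2 := by
  have hF := V.isPadicInt_formalGroupLaw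
  have h1 := hσ.powerSeries_subst hF V.hasSubst_formalGroupLaw
  have hFs := V.isPadicInt_formalGroupLawSub
  have h2 := hσ.powerSeries_subst hFs
    (PowerSeries.HasSubst.of_constantCoeff_zero V.constantCoeff_formalGroupLawSub)
  have hX0 : IsPadicInt ((MvPowerSeries.X 0 : MvPowerSeries (Fin 2) ℚ_[p]) ^ 2) := (IsPadicInt.X 0).pow 2
  have hX1 : IsPadicInt ((MvPowerSeries.X 1 : MvPowerSeries (Fin 2) ℚ_[p]) ^ 2) := (IsPadicInt.X 1).pow 2
  unfold thetaLHS
  rw [padicEval₂_mul ((h1.mul h2).mul hX0) hX1 hu hv, padicEval₂_mul (h1.mul h2) hX0 hu hv,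
    padicEval₂_mul h1 h2 hu hv, padicEval₂_pow (IsPadicInt.X 0) hu hv, padicEval₂_pow (IsPadicInt.X 1) hu hv,
    padicEval₂_X, padicEval₂_X, padicEval₂_subst hσ hF V.constantCoeff_formalGroupLaw hu hv,
    padicEval₂_subst hσ hFs V.constantCoeff_formalGroupLawSub hu hv]
  unfold formalGroupLawSub
  rw [padicEval₂_substPair hF (IsPadicInt.X 0) (V.isPadicInt_formalNeg.powerSeries_subst
      (IsPadicInt.X 1) (PowerSeries.HasSubst.X 1)) (MvPowerSeries.constantCoeff_X 0)
      (V.constantCoeff_formalNeg_subst_X 1) hu hv,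
    padicEval₂_X, padicEval₂_subst_X V.isPadicInt_formalNeg hu hv]
  rfl

variable {V} in
/-- **Value of the right side**: `thetaRHS(u, v) = (u² X̂(v) - v² X̂(u)) · σ̂(u)² · σ̂(v)²`.
[folklore] -/
theorem padicEval₂_thetaRHS {σ : ℚ_[p]⟦X⟧} (hσ : IsPadicInt σ) {u v : ℚ_[p]} (hu : ‖u‖ < 1)
    (hv : ‖v‖ < 1) :
    padicEval₂ (V.thetaRHS σ) u v =
      (u ^ 2 * padicEval V.formalXMulSq v - v ^ 2 * padicEval V.formalXMulSq u) *
        padicEval σ u ^ 2 * padicEval σ v ^ 2 := by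
  have hXs0 := V.isPadicInt_formalXMulSq.powerSeries_subst (IsPadicInt.X (0 : Fin 2))
    (PowerSeries.HasSubst.X 0)
  have hXs1 := V.isPadicInt_formalXMulSq.powerSeries_subst (IsPadicInt.X (1 : Fin 2))
    (PowerSeries.HasSubst.X 1)
  have hs0 := hσ.powerSeries_subst (IsPadicInt.X (0 : Fin 2)) (PowerSeries.HasSubst.X 0)
  have hs1 := hσ.powerSeries_subst (IsPadicInt.X (1 : Fin 2)) (PowerSeries.HasSubst.X 1)
  have hX0 : IsPadicInt ((MvPowerSeries.X 0 : MvPowerSeries (Fin 2) ℚ_[p]) ^ 2) := (IsPadicInt.X 0).pow 2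
  have hX1 : IsPadicInt ((MvPowerSeries.X 1 : MvPowerSeries (Fin 2) ℚ_[p]) ^ 2) := (IsPadicInt.X 1).pow 2
  have hd := (hX0.mul hXs1).sub (hX1.mul hXs0)
  unfold thetaRHS
  rw [padicEval₂_mul (hd.mul (hs0.pow 2)) (hs1.pow 2) hu hv, padicEval₂_mul hd (hs0.pow 2) hu hv,
    padicEval₂_sub (hX0.mul hXs1) (hX1.mul hXs0) hu hv, padicEval₂_mul hX0 hXs1 hu hv,
    padicEval₂_mul hX1 hXs0 hu hv, padicEval₂_pow hs0 hu hv, padicEval₂_pow hs1 hu hv,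
    padicEval₂_pow (IsPadicInt.X 0) hu hv, padicEval₂_pow (IsPadicInt.X 1) hu hv, padicEval₂_X,
    padicEval₂_X, padicEval₂_subst_X V.isPadicInt_formalXMulSq hu hv,
    padicEval₂_subst_X V.isPadicInt_formalXMulSq hu hv, padicEval₂_subst_X hσ hu hv,
    padicEval₂_subst_X hσ hu hv]
  rfl

end PadicIntegrality

/-! ### From `E(ℚ)` to `E(ℚ_p)`: the base-change homomorphism on points -/

section RationalPoints

variable (W : WeierstrassCurve ℚ) (p : ℕ) [Fact p.Prime]

/-- A `ℤ`-integral equation is `ℤ_p`-integral after base change to `ℚ_p`. [folklore] -/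
instance isIntegral_padicInt_baseChange [hW : W.IsIntegral ℤ] :
    (W.baseChange ℚ_[p]).IsIntegral ℤ_[p] := by
  obtain ⟨V, hV⟩ := hW.integral
  refine ⟨V.map (Int.castRingHom ℤ_[p]), ?_⟩
  rw [hV, baseChange, baseChange, baseChange, map_map, map_map]
  congr 1

/-- The homomorphism `E(ℚ) → E(ℚ_p)` on points (Mathlib's `Point.map` along `ℚ → ℚ_p`).
[folklore] -/
abbrev toPadicPoint : W.toAffine.Point →+ (W.baseChange ℚ_[p]).toAffine.Point :=
  WeierstrassCurve.Affine.Point.map (W' := W.toAffine) (S := ℚ) (Algebra.ofId ℚ ℚ_[p])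

variable {W p}

/-- A rational affine point gives the `ℚ_p`-point with the cast coordinates. [folklore] -/
theorem nonsingular_ratCast {x y : ℚ} (h : W.toAffine.Nonsingular x y) :
    (W.baseChange ℚ_[p]).toAffine.Nonsingular (x : ℚ_[p]) (y : ℚ_[p]) := by
  have := (Affine.baseChange_nonsingular (W := W.toAffine) (f := Algebra.ofId ℚ ℚ_[p])
    (Algebra.ofId ℚ ℚ_[p]).toRingHom.injective x y).mpr h
  simpa only [eq_ratCast] using this

/-- `toPadicPoint (x, y) = (↑x, ↑y)`. [folklore] -/
theorem toPadicPoint_some {x y : ℚ} (h : W.toAffine.Nonsingular x y) :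
    W.toPadicPoint p (.some x y h) = .some (x : ℚ_[p]) (y : ℚ_[p]) (nonsingular_ratCast h) := by
  refine (Affine.Point.map_some (W' := W.toAffine) (Algebra.ofId ℚ ℚ_[p]) h).trans ?_
  congr 1

/-- The parameter of the image point is the tree's `padicParam`. [folklore] -/
theorem formalParameter_toPadicPoint (R : W.toAffine.Point) :
    (W.baseChange ℚ_[p]).formalParameter (W.toPadicPoint p R) = W.padicParam p R := by
  rcases R with _ | ⟨x, y, h⟩
  · rfl
  · rw [toPadicPoint_some]; rfl

/-- `σ_p(R) = σ̂_p(z(R))` with the general evaluation of `PadicSeriesEvaluation.lean`. [folklore] -/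
theorem padicSigmaAt_eq_padicEval (R : W.toAffine.Point) :
    W.padicSigmaAt p R = padicEval (W.baseChange ℚ_[p]).padicSigma (W.padicParam p R) := rfl

end RationalPoints

/-! ### The assembly: `padicSigma_theta` from θ₁ (existence), θ₂ (formal theta), θ₃ (group law) -/

/-- **The Mazur–Tate theta relation at rational points of the kernel of reduction** from:
existence of the Mazur–Tate pair (`mazur_tate_sigma_existsUnique`, MST 2006 Thm. 1.3), the
formal theta identity (`padicSigma_theta_formal`, Blakestad–Grant 2023 Prop. 14 / MT 1991
Thm. 3.1) and the convergence of the formal group law to the chord-tangent sum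
(`formalGroupLaw_padicEval`, AEC IV.1–2/VII.2.2). Proof: evaluate the formal identity at
`(u, v) = (z(P), z(Q)) ∈ (pℤ_p)²` through the evaluation homomorphism
(`padicEval₂_thetaLHS/RHS`), read `F̂(u, v) = z(P+Q)`, `F̂(u, î(v)) = F̂(z P, z(-Q)) = z(P-Q)`,
`X̂(u) = x(P)u²`, and cancel `u²v² ≠ 0`. [Mazur–Tate 1991, Thm. 3.1; Blakestad–Grant 2023,
Prop. 14 and Thm. 15 (specialisation `t₁ ↦ t(u)`, `t₂ ↦ t(v)`)] [cite: BlakestadGrant2023, Thm. 15] -/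
theorem padicSigma_theta_of_formal (hMT : mazur_tate_sigma_existsUnique)
    (hθ : padicSigma_theta_formal) (hF : formalGroupLaw_padicEval) : padicSigma_theta := by
  intro W _ _ p _ hp hgood hord x₁ y₁ x₂ y₂ h₁ h₂ hx₁ hx₂ hne
  set V := W.baseChange ℚ_[p] with hVdef
  -- θ₁: the Mazur–Tate pair exists, so `padicSigma` is one
  obtain ⟨⟨σ₀, c₀⟩, hσ₀, -⟩ := hMT W p hp hgood hord
  have hpair : V.IsMazurTateSigmaPair V.padicSigma V.padicSigmaConst :=
    V.isMazurTateSigmaPair_padicSigma ⟨σ₀, c₀, hσ₀⟩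
  have hσint : IsPadicInt V.padicSigma := isPadicInt_iff_coeff.mpr hpair.norm_coeff_le
  -- θ₂ and θ₃
  have hΘ := hθ W p hp hgood hord V.padicSigma V.padicSigmaConst hpair
  have hFadd := hF p V
  -- the points over `ℚ_p`
  set ι := W.toPadicPoint p with hιdef
  set P : W.toAffine.Point := .some x₁ y₁ h₁ with hPdef
  set Q : W.toAffine.Point := .some x₂ y₂ h₂ with hQdef
  have hιP : ι P = .some (x₁ : ℚ_[p]) (y₁ : ℚ_[p]) (nonsingular_ratCast h₁) := toPadicPoint_some h₁
  have hιQ : ι Q = .some (x₂ : ℚ_[p]) (y₂ : ℚ_[p]) (nonsingular_ratCast h₂) := toPadicPoint_some h₂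
  have hιnQ : ι (-Q) = .some (x₂ : ℚ_[p]) (V.toAffine.negY (x₂ : ℚ_[p]) (y₂ : ℚ_[p]))
      ((Affine.nonsingular_neg ..).mpr (nonsingular_ratCast h₂)) := by
    rw [map_neg, hιQ, Affine.Point.neg_some]
  have hkP : V.IsInReductionKernel (ι P) := by rw [hιP]; exact hx₁
  have hkQ : V.IsInReductionKernel (ι Q) := by rw [hιQ]; exact hx₂
  have hknQ : V.IsInReductionKernel (ι (-Q)) := by rw [hιnQ]; exact hx₂
  -- parameters
  obtain ⟨hy₁, hu0, hu1, -, -⟩ := V.param_facts (nonsingular_ratCast (p := p) h₁).1 hx₁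
  obtain ⟨hy₂, hv0, hv1, -, -⟩ := V.param_facts (nonsingular_ratCast (p := p) h₂).1 hx₂
  set u : ℚ_[p] := -(x₁ : ℚ_[p]) / y₁ with hudef
  set v : ℚ_[p] := -(x₂ : ℚ_[p]) / y₂ with hvdef
  have hzP : V.formalParameter (ι P) = u := by rw [hιP]; rfl
  have hzQ : V.formalParameter (ι Q) = v := by rw [hιQ]; rfl
  have hznQ : V.formalParameter (ι (-Q)) = padicEval V.formalNeg v := by
    rw [hιnQ, V.padicEval_formalNeg_eq (nonsingular_ratCast (p := p) h₂).1 hx₂]; rfl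
  -- θ₃ at `(P, Q)` and `(P, -Q)`
  have hadd : padicEval₂ V.formalGroupLaw u v = W.padicParam p (P + Q) := by
    rw [← hzP, ← hzQ, hFadd _ _ hkP hkQ, ← map_add, formalParameter_toPadicPoint]
  have hsub : padicEval₂ V.formalGroupLaw u (padicEval V.formalNeg v) = W.padicParam p (P - Q) := by
    rw [← hzP, ← hznQ, hFadd _ _ hkP hknQ, ← map_add, ← sub_eq_add_neg, formalParameter_toPadicPoint]
  -- the dictionary for `X = z²x`
  have hXu : padicEval V.formalXMulSq u = (x₁ : ℚ_[p]) * u ^ 2 :=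
    V.padicEval_formalXMulSq_eq (nonsingular_ratCast (p := p) h₁).1 hx₁
  have hXv : padicEval V.formalXMulSq v = (x₂ : ℚ_[p]) * v ^ 2 :=
    V.padicEval_formalXMulSq_eq (nonsingular_ratCast (p := p) h₂).1 hx₂
  -- evaluate θ₂ at `(u, v)`
  have key := congrArg (fun G => padicEval₂ G u v) hΘ
  rw [padicEval₂_thetaLHS hσint hu1 hv1, padicEval₂_thetaRHS hσint hu1 hv1, hadd, hsub, hXu,
    hXv] at key
  -- read the sigma values and cancel `u² v²`
  simp only [padicSigmaAt_eq_padicEval]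
  rw [show W.padicParam p P = u from rfl, show W.padicParam p Q = v from rfl]
  have huv : u ^ 2 * v ^ 2 ≠ 0 := mul_ne_zero (pow_ne_zero 2 hu0) (pow_ne_zero 2 hv0)
  apply mul_right_cancel₀ huv
  linear_combination key

/-- **Existence of the canonical `p`-adic height datum from θ₁, θ₂, θ₃** — the three named
facts now behind `WeierstrassCurve.exists_isCanonical`: the Mazur–Tate pair exists
(MST 2006 Thm. 1.3), the formal theta identity (Blakestad–Grant 2023 Prop. 14 / MT 1991
Thm. 3.1), and the formal group law computes the group law on `E₁(ℚ_p)` (AEC IV.1–2,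
VII.2.2). Everything else in the printed argument (MST 2006 §1, §2.6–2.7; SW 2013 §4.1) is a
theorem of the tree. [Mazur–Stein–Tate 2006, §2.7; Stein–Wuthrich 2013, §4.1 eq. (4.1)]
[cite: MazurSteinTate2006, §2.7] -/
theorem exists_isCanonical_of_formal (hMT : mazur_tate_sigma_existsUnique)
    (hθ : padicSigma_theta_formal) (hF : formalGroupLaw_padicEval) : exists_isCanonical :=
  exists_isCanonical_of_padicSigma_theta (padicSigma_theta_of_formal hMT hθ hF)

/-- The same with uniqueness, given admissible multiples. [Mazur–Stein–Tate 2006, §1] [folklore] -/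
theorem existsUnique_isCanonical_of_formal (hMT : mazur_tate_sigma_existsUnique)
    (hθ : padicSigma_theta_formal) (hF : formalGroupLaw_padicEval) (hS : exists_admissible_nsmul)
    (W : WeierstrassCurve ℚ) [W.IsElliptic] [W.IsGloballyMinimal] (p : ℕ) [Fact p.Prime]
    (hp : 5 ≤ p) (hgood : W.HasGoodReductionAtPrime p) (hord : ¬ (p : ℤ) ∣ W.frobeniusTrace p) :
    ∃! D : PAdicHeightData W p, D.IsCanonical :=
  existsUnique_isCanonical_of_padicSigma_theta (padicSigma_theta_of_formal hMT hθ hF) hS W p hp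
    hgood hord

end WeierstrassCurve
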